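import Summits.PneNP.PneNP.Theorems.KarlinRubinMonotoneSufficesTransportCounting
import Summits.PneNP.PneNP.Theorems.KarlinRubinMonotoneSufficesTransportBinomial
import Summits.PneNP.PneNP.Theorems.KarlinRubinMonotoneSufficesTransportCircuit
import Summits.PneNP.PneNP.Theorems.KarlinRubinMonotoneSufficesTransportSlices

/-!
# Crux `MonotoneSuffices` (stmt-PneNP-18026), line `slice-transport` — stub `stub_transport`, part 6:
# the slice errors of the transported test, averaged over the rankings

Generic setting: a test `f` on the cube `α → Bool` (`N = |α|`), a nonempty finite family of
protected sets `Kf A` (`A ∈ 𝒜`), all of size `κ` (the planted cliques' edge sets), a slice `m` and a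
deletion count `d ≤ m`. For the gadget `del σ d` (delete the `d` lowest-ranked present coordinates,
parts 1, 2, 4) the SUM OVER ALL RANKINGS `σ` of

  slice type-I error of `f ∘ del σ d` at `m` (`#{x : |x| = m, f (del x)} / C(N, m)`) and
  slice type-II error at `m` (`#{(A, x) : Kf A ⊆ supp x, |x| = m, ¬ f (del x)} / #{(A, x) : …}`)

is at most `#rankings · ( acc_{m-d}(f)/C(N, m-d) + κ d / m + rej_{m-d}(f) )`, where
`acc_j(f) = #{y : |y| = j, f y}` and `rej_j(f) = #{(A, y) : Kf A ⊆ supp y, |y| = j, ¬ f y} /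
(#𝒜 · C(N-κ, j-κ))` (`transport_average`): the null part is EXACT (the transported slice-`m` law is
the uniform slice-`(m-d)` law), the planted part loses the bad event (deleted set meets `Kf A`,
probability `≤ κ d/m`) and is otherwise the uniform planted slice-`(m-d)` law.
-/

set_option linter.dupNamespace false -- `Summit.PneNP.PneNP.…`: summit = sub-problem name (D-0017 single-conjunct layout)

namespace Summit.PneNP.PneNP.Theorems.MonotoneSuffices.SliceTransport

open Finset

variable {α : Type*} [Fintype α] [DecidableEq α] {θ : Type*}

/-! ### The null part (exact) -/

/-- **Null part.** Summed over all rankings, the number of weight-`m` vectors whose transported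
image is accepted, times `C(m,d)`, is `#rankings · C(N-(m-d), d) · acc_{m-d}`. [folklore] -/
theorem sum_card_accept_del (f : (α → Bool) → Bool) {m d : ℕ} (hd : d ≤ m) :
    (∑ σ : α ≃ Fin (Fintype.card α),
      (#((univ : Finset (α → Bool)).filter fun x => #(univ.filter fun a => x a = true) = m ∧
        f (fun a => x a && decide (d ≤ #(univ.filter fun b => x b = true ∧ σ b < σ a))) = true) : ℝ)) *
        (m.choose d : ℝ) =
    (Fintype.card (α ≃ Fin (Fintype.card α)) : ℝ) * ((Fintype.card α - (m - d)).choose d : ℝ) *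
      #((univ : Finset (α → Bool)).filter fun y => #(univ.filter fun a => y a = true) = m - d ∧ f y = true) := by
  classical
  have h := transport_counting_good (α := α) (∅ : Finset α) hd (fun y => if f y = true then (1 : ℝ) else 0)
  simp only [empty_subset, and_true, disjoint_empty_right, ↓reduceIte] at h
  -- identify the two sides
  have lhs : ∀ σ : α ≃ Fin (Fintype.card α),
      (∑ x ∈ (univ : Finset (α → Bool)).filter (fun x => #(univ.filter fun a => x a = true) = m),
        (if f (fun a => x a && !decide (a ∈ (univ.filter fun a => x a = true).filter fun a =>
            #((univ.filter fun a => x a = true).filter fun c => σ c < σ a) < d)) = true then (1 : ℝ) else 0)) =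
      #((univ : Finset (α → Bool)).filter fun x => #(univ.filter fun a => x a = true) = m ∧
        f (fun a => x a && decide (d ≤ #(univ.filter fun b => x b = true ∧ σ b < σ a))) = true) := by
    intro σ
    rw [← sum_boole, sum_filter]
    refine sum_congr rfl fun x _ => ?_
    rw [del_eq_sdiff_lowest σ d x]
    by_cases hx : #(univ.filter fun a => x a = true) = m <;> simp [hx]
  have rhs : (∑ y ∈ (univ : Finset (α → Bool)).filter (fun y => #(univ.filter fun a => y a = true) = m - d),
      (if f y = true then (1 : ℝ) else 0)) =
      #((univ : Finset (α → Bool)).filter fun y => #(univ.filter fun a => y a = true) = m - d ∧ f y = true) := by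
    rw [← sum_boole, sum_filter]
    refine sum_congr rfl fun y _ => ?_
    by_cases hy : #(univ.filter fun a => y a = true) = m - d <;> simp [hy]
  rw [sum_congr rfl fun σ _ => lhs σ, rhs] at h
  exact h

/-- **Null slice error, averaged**: `∑_σ sliceErrI_m(f ∘ del σ d) = #rankings · acc_{m-d}/C(N, m-d)`
(`d ≤ m ≤ N`). [folklore] -/
theorem sum_sliceErrI_del (f : (α → Bool) → Bool) {m d : ℕ} (hd : d ≤ m) (hm : m ≤ Fintype.card α) :
    ∑ σ : α ≃ Fin (Fintype.card α),
      (#((univ : Finset (α → Bool)).filter fun x => #(univ.filter fun a => x a = true) = m ∧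
        f (fun a => x a && decide (d ≤ #(univ.filter fun b => x b = true ∧ σ b < σ a))) = true) : ℝ) /
        #((univ : Finset (α → Bool)).filter fun x => #(univ.filter fun a => x a = true) = m) =
    (Fintype.card (α ≃ Fin (Fintype.card α)) : ℝ) *
      (#((univ : Finset (α → Bool)).filter fun y => #(univ.filter fun a => y a = true) = m - d ∧ f y = true) : ℝ) /
        ((Fintype.card α).choose (m - d) : ℝ) := by
  set N := Fintype.card α with hN
  have hslice : (#((univ : Finset (α → Bool)).filter fun x => #(univ.filter fun a => x a = true) = m) : ℝ) =
      (N.choose m : ℝ) := by rw [card_slice_eq_choose]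
  have hCm : (0 : ℝ) < N.choose m := by exact_mod_cast Nat.choose_pos hm
  have hCmd : (0 : ℝ) < m.choose d := by exact_mod_cast Nat.choose_pos hd
  have hCNmd : (0 : ℝ) < N.choose (m - d) := by exact_mod_cast Nat.choose_pos (by omega)
  -- `C(N,m) C(m,d) = C(N, m-d) C(N-(m-d), d)`
  have hid : (N.choose m : ℝ) * m.choose d = N.choose (m - d) * (N - (m - d)).choose d := by
    have h1 := Nat.choose_mul (n := N) (Nat.sub_le m d)
    rw [Nat.choose_symm hd, show m - (m - d) = d by omega] at h1
    exact_mod_cast h1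
  have h := sum_card_accept_del f hd (α := α)
  rw [← hN] at h
  set A : ℝ := ∑ σ : α ≃ Fin N,
      (#((univ : Finset (α → Bool)).filter fun x => #(univ.filter fun a => x a = true) = m ∧
        f (fun a => x a && decide (d ≤ #(univ.filter fun b => x b = true ∧ σ b < σ a))) = true) : ℝ) with hA
  set acc : ℝ := (#((univ : Finset (α → Bool)).filter fun y => #(univ.filter fun a => y a = true) = m - d ∧
    f y = true) : ℝ) with hacc
  set E : ℝ := (Fintype.card (α ≃ Fin N) : ℝ) with hE
  rw [← sum_div, hslice, div_eq_div_iff hCm.ne' hCNmd.ne']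
  have h2 : A * (N.choose (m - d) : ℝ) * (m.choose d : ℝ) = E * acc * (N.choose m : ℝ) * (m.choose d : ℝ) := by
    calc A * (N.choose (m - d) : ℝ) * (m.choose d : ℝ) = (A * (m.choose d : ℝ)) * (N.choose (m - d) : ℝ) := by ring
      _ = E * ((N - (m - d)).choose d : ℝ) * acc * (N.choose (m - d) : ℝ) := by rw [h]
      _ = E * acc * ((N.choose (m - d) : ℝ) * ((N - (m - d)).choose d : ℝ)) := by ring
      _ = E * acc * ((N.choose m : ℝ) * (m.choose d : ℝ)) := by rw [hid]
      _ = _ := by ring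
  exact mul_right_cancel₀ hCmd.ne' h2

/-! ### The planted part -/

/-- **Planted part, one protected set, counted.** For `K` of size `κ ≤ m`: summed over all rankings,
the number of weight-`m` vectors `x ⊇ K` whose transported image is REJECTED is at most
`#S_m(K) · #rankings · κ d/m + #rankings · C(N-(m-d),d) · rej^K_{m-d} / C(m,d)`. [folklore] -/
theorem sum_card_reject_del_le (f : (α → Bool) → Bool) (K : Finset α) {m d : ℕ} (hd : d ≤ m)
    (hκ : #K ≤ m) (hm1 : 1 ≤ m) :
    ∑ σ : α ≃ Fin (Fintype.card α),
      (#((univ : Finset (α → Bool)).filter fun x => #(univ.filter fun a => x a = true) = m ∧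
        K ⊆ (univ.filter fun a => x a = true) ∧
        f (fun a => x a && decide (d ≤ #(univ.filter fun b => x b = true ∧ σ b < σ a))) = false) : ℝ) ≤
    (#((univ : Finset (α → Bool)).filter fun x => #(univ.filter fun a => x a = true) = m ∧
        K ⊆ univ.filter fun a => x a = true) : ℝ) *
      (Fintype.card (α ≃ Fin (Fintype.card α)) : ℝ) * ((#K : ℝ) * d / m) +
    (Fintype.card (α ≃ Fin (Fintype.card α)) : ℝ) * ((Fintype.card α - (m - d)).choose d : ℝ) *
      #((univ : Finset (α → Bool)).filter fun y => #(univ.filter fun a => y a = true) = m - d ∧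
        K ⊆ (univ.filter fun a => y a = true) ∧ f y = false) / (m.choose d : ℝ) := by
  classical
  set N := Fintype.card α with hN
  set S : Finset (α → Bool) := (univ : Finset (α → Bool)).filter fun x =>
    #(univ.filter fun a => x a = true) = m ∧ K ⊆ univ.filter fun a => x a = true with hS
  -- abbreviations for the lowest set and the two indicators
  set T : (α ≃ Fin N) → (α → Bool) → Finset α := fun σ x =>
    (univ.filter fun a => x a = true).filter fun a => #((univ.filter fun a => x a = true).filter fun c => σ c < σ a) < d
    with hT
  have hCmd : (0 : ℝ) < m.choose d := by exact_mod_cast Nat.choose_pos hd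
  -- pointwise: rejected ≤ bad + (good ∧ rejected)
  have hpt : ∀ (σ : α ≃ Fin N) (x : α → Bool),
      (if f (fun a => x a && decide (d ≤ #(univ.filter fun b => x b = true ∧ σ b < σ a))) = false then (1 : ℝ) else 0) ≤
      (if ¬ Disjoint (T σ x) K then (1 : ℝ) else 0) +
        (if Disjoint (T σ x) K then (if f (fun a => x a && !decide (a ∈ T σ x)) = false then (1 : ℝ) else 0) else 0) := by
    intro σ x
    rw [del_eq_sdiff_lowest σ d x]
    show (if f (fun a => x a && !decide (a ∈ T σ x)) = false then (1 : ℝ) else 0) ≤ _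
    by_cases hD : Disjoint (T σ x) K <;> by_cases hf : f (fun a => x a && !decide (a ∈ T σ x)) = false <;>
      simp [hD, hf]
  -- the left side as a double sum of indicators over `S`
  have lhs : ∀ σ : α ≃ Fin N,
      (#((univ : Finset (α → Bool)).filter fun x => #(univ.filter fun a => x a = true) = m ∧
        K ⊆ (univ.filter fun a => x a = true) ∧
        f (fun a => x a && decide (d ≤ #(univ.filter fun b => x b = true ∧ σ b < σ a))) = false) : ℝ) =
      ∑ x ∈ S, (if f (fun a => x a && decide (d ≤ #(univ.filter fun b => x b = true ∧ σ b < σ a))) = false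
        then (1 : ℝ) else 0) := by
    intro σ
    rw [← sum_boole, hS, sum_filter]
    refine sum_congr rfl fun x _ => ?_
    by_cases h1 : #(univ.filter fun a => x a = true) = m <;>
      by_cases h2 : K ⊆ univ.filter (fun a => x a = true) <;> simp [h1, h2]
  -- (a) the bad part: per `x ∈ S`, `#{σ : ¬Disjoint} ≤ #Eq κ d / m`
  have hbad : ∀ x ∈ S, ∑ σ : α ≃ Fin N, (if ¬ Disjoint (T σ x) K then (1 : ℝ) else 0) ≤
      (Fintype.card (α ≃ Fin N) : ℝ) * ((#K : ℝ) * d / m) := by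
    intro x hx
    rw [hS, mem_filter] at hx
    obtain ⟨-, hxm, hKx⟩ := hx
    have hcount := transport_counting_bad K hd x hxm hKx
    have hsum : ∑ σ : α ≃ Fin N, (if ¬ Disjoint (T σ x) K then (1 : ℝ) else 0) =
        #((univ : Finset (α ≃ Fin N)).filter fun σ => ¬ Disjoint (T σ x) K) := by
      rw [← sum_boole]
    rw [hsum]
    have hratio := one_sub_choose_ratio_le (m := m) (κ := #K) (d := d) hκ hd hm1
    -- `#bad · C(m,d) = #Eq (C(m,d) - C(m-κ,d))` hence `#bad = #Eq (1 - ratio) ≤ #Eq κ d/m`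
    have hc : (#((univ : Finset (α ≃ Fin N)).filter fun σ => ¬ Disjoint (T σ x) K) : ℝ) * (m.choose d : ℝ) =
        (Fintype.card (α ≃ Fin N) : ℝ) * ((m.choose d : ℝ) - ((m - #K).choose d : ℝ)) := hcount
    have h1 : (#((univ : Finset (α ≃ Fin N)).filter fun σ => ¬ Disjoint (T σ x) K) : ℝ) =
        (Fintype.card (α ≃ Fin N) : ℝ) * (1 - (((m - #K).choose d : ℕ) : ℝ) / (m.choose d : ℝ)) := by
      have : (#((univ : Finset (α ≃ Fin N)).filter fun σ => ¬ Disjoint (T σ x) K) : ℝ) =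
          (Fintype.card (α ≃ Fin N) : ℝ) * ((m.choose d : ℝ) - ((m - #K).choose d : ℝ)) / (m.choose d : ℝ) := by
        rw [eq_div_iff hCmd.ne']
        exact hc
      rw [this]
      field_simp
    rw [h1]
    exact mul_le_mul_of_nonneg_left hratio (Nat.cast_nonneg _)
  -- (b) the good part, summed over `σ` and `x`: `transport_counting_good`
  have hgood := transport_counting_good (α := α) K hd (fun y => if f y = false then (1 : ℝ) else 0)
  have hgoodS : (∑ σ : α ≃ Fin N, ∑ x ∈ S,
      (if Disjoint (T σ x) K then (if f (fun a => x a && !decide (a ∈ T σ x)) = false then (1 : ℝ) else 0) else 0)) =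
      (Fintype.card (α ≃ Fin N) : ℝ) * ((N - (m - d)).choose d : ℝ) *
        #((univ : Finset (α → Bool)).filter fun y => #(univ.filter fun a => y a = true) = m - d ∧
          K ⊆ (univ.filter fun a => y a = true) ∧ f y = false) / (m.choose d : ℝ) := by
    rw [eq_div_iff hCmd.ne']
    have hrhs : (∑ y ∈ (univ : Finset (α → Bool)).filter (fun y => #(univ.filter fun a => y a = true) = m - d ∧
        K ⊆ univ.filter fun a => y a = true), (if f y = false then (1 : ℝ) else 0)) =
        #((univ : Finset (α → Bool)).filter fun y => #(univ.filter fun a => y a = true) = m - d ∧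
          K ⊆ (univ.filter fun a => y a = true) ∧ f y = false) := by
      rw [← sum_boole, sum_filter]
      refine sum_congr rfl fun y _ => ?_
      by_cases h1 : #(univ.filter fun a => y a = true) = m - d <;>
        by_cases h2 : K ⊆ univ.filter (fun a => y a = true) <;> simp [h1, h2]
    rw [hrhs] at hgood
    rw [hT, hS]
    exact hgood
  -- assemble
  calc ∑ σ : α ≃ Fin N, (#((univ : Finset (α → Bool)).filter fun x => #(univ.filter fun a => x a = true) = m ∧
          K ⊆ (univ.filter fun a => x a = true) ∧
          f (fun a => x a && decide (d ≤ #(univ.filter fun b => x b = true ∧ σ b < σ a))) = false) : ℝ)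
      = ∑ σ : α ≃ Fin N, ∑ x ∈ S, (if f (fun a => x a && decide (d ≤ #(univ.filter fun b => x b = true ∧ σ b < σ a)))
          = false then (1 : ℝ) else 0) := sum_congr rfl fun σ _ => lhs σ
    _ ≤ ∑ σ : α ≃ Fin N, ∑ x ∈ S, ((if ¬ Disjoint (T σ x) K then (1 : ℝ) else 0) +
          (if Disjoint (T σ x) K then (if f (fun a => x a && !decide (a ∈ T σ x)) = false then (1 : ℝ) else 0)
            else 0)) := sum_le_sum fun σ _ => sum_le_sum fun x _ => hpt σ x
    _ = (∑ x ∈ S, ∑ σ : α ≃ Fin N, (if ¬ Disjoint (T σ x) K then (1 : ℝ) else 0)) +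
          ∑ σ : α ≃ Fin N, ∑ x ∈ S, (if Disjoint (T σ x) K then
            (if f (fun a => x a && !decide (a ∈ T σ x)) = false then (1 : ℝ) else 0) else 0) := by
        rw [sum_comm (s := univ) (t := S)]
        simp only [sum_add_distrib]
        congr 1
        exact sum_comm
    _ ≤ (∑ _x ∈ S, (Fintype.card (α ≃ Fin N) : ℝ) * ((#K : ℝ) * d / m)) +
          (Fintype.card (α ≃ Fin N) : ℝ) * ((N - (m - d)).choose d : ℝ) *
            #((univ : Finset (α → Bool)).filter fun y => #(univ.filter fun a => y a = true) = m - d ∧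
              K ⊆ (univ.filter fun a => y a = true) ∧ f y = false) / (m.choose d : ℝ) := by
        rw [hgoodS]
        exact add_le_add (sum_le_sum hbad) le_rfl
    _ = _ := by rw [sum_const, nsmul_eq_mul]; ring

/-- Cardinality of a filtered product as an iterated sum of fibre cardinalities. [folklore] -/
theorem card_filter_product_eq_sum {β γ : Type*} (s : Finset β) (t : Finset γ) (P : β × γ → Prop)
    [DecidablePred P] :
    (#((s ×ˢ t).filter P) : ℝ) = ∑ b ∈ s, (#(t.filter fun c => P (b, c)) : ℝ) := by
  classical
  rw [card_filter, Nat.cast_sum, sum_product]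
  refine sum_congr rfl fun b _ => ?_
  rw [card_filter, Nat.cast_sum]

/-- **Planted slice error, averaged**: with all protected sets of size `κ ≤ m` and `𝒜` nonempty,
`∑_σ sliceErrII_m(f ∘ del σ d) ≤ #rankings · (κ d/m + rej_{m-d})`, where
`rej_j = #{(A,y) : Kf A ⊆ supp y, |y| = j, ¬ f y} / (#𝒜 · C(N-κ, j-κ))` (`d ≤ m ≤ N`, `1 ≤ m`).
[folklore] -/
theorem sum_sliceErrII_del_le (f : (α → Bool) → Bool) (𝒜 : Finset θ) (h𝒜 : 𝒜.Nonempty)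
    (Kf : θ → Finset α) {κ m d : ℕ} (hκ : ∀ A ∈ 𝒜, #(Kf A) = κ) (hκm : κ ≤ m) (hd : d ≤ m)
    (hm : m ≤ Fintype.card α) (hm1 : 1 ≤ m) :
    ∑ σ : α ≃ Fin (Fintype.card α),
      (#((𝒜 ×ˢ (univ : Finset (α → Bool))).filter fun p =>
          Kf p.1 ⊆ (univ.filter fun a => p.2 a = true) ∧ #(univ.filter fun a => p.2 a = true) = m ∧
          f (fun a => p.2 a && decide (d ≤ #(univ.filter fun b => p.2 b = true ∧ σ b < σ a))) = false) : ℝ) /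
        #((𝒜 ×ˢ (univ : Finset (α → Bool))).filter fun p =>
          Kf p.1 ⊆ (univ.filter fun a => p.2 a = true) ∧ #(univ.filter fun a => p.2 a = true) = m) ≤
    (Fintype.card (α ≃ Fin (Fintype.card α)) : ℝ) * ((κ : ℝ) * d / m +
      (#((𝒜 ×ˢ (univ : Finset (α → Bool))).filter fun p =>
          Kf p.1 ⊆ (univ.filter fun a => p.2 a = true) ∧ #(univ.filter fun a => p.2 a = true) = m - d ∧
          f p.2 = false) : ℝ) / ((#𝒜 : ℝ) * ((Fintype.card α - κ).choose (m - d - κ) : ℝ))) := by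
  classical
  set N := Fintype.card α with hN
  set E : ℝ := (Fintype.card (α ≃ Fin N) : ℝ) with hE
  -- the pair counts, fibrewise
  have hpairs : (#((𝒜 ×ˢ (univ : Finset (α → Bool))).filter fun p =>
      Kf p.1 ⊆ (univ.filter fun a => p.2 a = true) ∧ #(univ.filter fun a => p.2 a = true) = m) : ℝ) =
      (#𝒜 : ℝ) * ((N - κ).choose (m - κ) : ℝ) := by
    rw [card_filter_product_eq_sum]
    have : ∀ A ∈ 𝒜, (#((univ : Finset (α → Bool)).filter fun x =>
        Kf A ⊆ (univ.filter fun a => x a = true) ∧ #(univ.filter fun a => x a = true) = m) : ℝ) =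
        ((N - κ).choose (m - κ) : ℝ) := by
      intro A hA
      have h := card_slice_supset (Kf A) (j := m) (by rw [hκ A hA]; exact hκm)
      rw [hκ A hA] at h
      rw [← h]
      congr 2
      ext x
      simp only [mem_filter, mem_univ, true_and, and_comm]
    rw [sum_congr rfl this, sum_const, nsmul_eq_mul]
  have h𝒜pos : (0 : ℝ) < #𝒜 := by exact_mod_cast h𝒜.card_pos
  have hchoose_pos : (0 : ℝ) < ((N - κ).choose (m - κ) : ℝ) := by
    exact_mod_cast Nat.choose_pos (by omega)
  have hpairs_pos : (0 : ℝ) < (#𝒜 : ℝ) * ((N - κ).choose (m - κ) : ℝ) := mul_pos h𝒜pos hchoose_pos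
  have hCmd : (0 : ℝ) < m.choose d := by exact_mod_cast Nat.choose_pos hd
  -- numerator, fibrewise, and the per-`A` bound of `sum_card_reject_del_le`
  set REJ : ℝ := (#((𝒜 ×ˢ (univ : Finset (α → Bool))).filter fun p =>
      Kf p.1 ⊆ (univ.filter fun a => p.2 a = true) ∧ #(univ.filter fun a => p.2 a = true) = m - d ∧
      f p.2 = false) : ℝ) with hREJ
  have hnum : ∑ σ : α ≃ Fin N, (#((𝒜 ×ˢ (univ : Finset (α → Bool))).filter fun p =>
      Kf p.1 ⊆ (univ.filter fun a => p.2 a = true) ∧ #(univ.filter fun a => p.2 a = true) = m ∧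
      f (fun a => p.2 a && decide (d ≤ #(univ.filter fun b => p.2 b = true ∧ σ b < σ a))) = false) : ℝ) ≤
      (#𝒜 : ℝ) * ((N - κ).choose (m - κ) : ℝ) * E * ((κ : ℝ) * d / m) +
        E * ((N - (m - d)).choose d : ℝ) * REJ / (m.choose d : ℝ) := by
    -- rewrite each summand fibrewise over `A`
    have hfib : ∀ σ : α ≃ Fin N, (#((𝒜 ×ˢ (univ : Finset (α → Bool))).filter fun p =>
        Kf p.1 ⊆ (univ.filter fun a => p.2 a = true) ∧ #(univ.filter fun a => p.2 a = true) = m ∧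
        f (fun a => p.2 a && decide (d ≤ #(univ.filter fun b => p.2 b = true ∧ σ b < σ a))) = false) : ℝ) =
        ∑ A ∈ 𝒜, (#((univ : Finset (α → Bool)).filter fun x => #(univ.filter fun a => x a = true) = m ∧
          Kf A ⊆ (univ.filter fun a => x a = true) ∧
          f (fun a => x a && decide (d ≤ #(univ.filter fun b => x b = true ∧ σ b < σ a))) = false) : ℝ) := by
      intro σ
      rw [card_filter_product_eq_sum]
      refine sum_congr rfl fun A _ => ?_
      congr 2
      ext x
      simp only [mem_filter, mem_univ, true_and]
      tauto
    have hREJfib : REJ = ∑ A ∈ 𝒜, (#((univ : Finset (α → Bool)).filter fun y =>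
        #(univ.filter fun a => y a = true) = m - d ∧ Kf A ⊆ (univ.filter fun a => y a = true) ∧ f y = false) : ℝ) := by
      rw [hREJ, card_filter_product_eq_sum]
      refine sum_congr rfl fun A _ => ?_
      congr 2
      ext y
      simp only [mem_filter, mem_univ, true_and]
      tauto
    rw [sum_congr rfl fun σ _ => hfib σ, sum_comm]
    have hA : ∀ A ∈ 𝒜, ∑ σ : α ≃ Fin N, (#((univ : Finset (α → Bool)).filter fun x =>
        #(univ.filter fun a => x a = true) = m ∧ Kf A ⊆ (univ.filter fun a => x a = true) ∧
        f (fun a => x a && decide (d ≤ #(univ.filter fun b => x b = true ∧ σ b < σ a))) = false) : ℝ) ≤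
        ((N - κ).choose (m - κ) : ℝ) * E * ((κ : ℝ) * d / m) +
          E * ((N - (m - d)).choose d : ℝ) * (#((univ : Finset (α → Bool)).filter fun y =>
            #(univ.filter fun a => y a = true) = m - d ∧ Kf A ⊆ (univ.filter fun a => y a = true) ∧ f y = false) : ℝ) /
            (m.choose d : ℝ) := by
      intro A hA
      have h := sum_card_reject_del_le f (Kf A) hd (by rw [hκ A hA]; exact hκm) hm1 (α := α)
      have hS : (#((univ : Finset (α → Bool)).filter fun x => #(univ.filter fun a => x a = true) = m ∧
          Kf A ⊆ univ.filter fun a => x a = true) : ℝ) = ((N - κ).choose (m - κ) : ℝ) := by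
        have hc := card_slice_supset (Kf A) (j := m) (by rw [hκ A hA]; exact hκm)
        rw [hκ A hA] at hc
        exact_mod_cast hc
      rw [hS, hκ A hA, ← hN] at h
      exact h
    calc ∑ A ∈ 𝒜, ∑ σ : α ≃ Fin N, (#((univ : Finset (α → Bool)).filter fun x =>
          #(univ.filter fun a => x a = true) = m ∧ Kf A ⊆ (univ.filter fun a => x a = true) ∧
          f (fun a => x a && decide (d ≤ #(univ.filter fun b => x b = true ∧ σ b < σ a))) = false) : ℝ)
        ≤ ∑ A ∈ 𝒜, (((N - κ).choose (m - κ) : ℝ) * E * ((κ : ℝ) * d / m) +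
          E * ((N - (m - d)).choose d : ℝ) * (#((univ : Finset (α → Bool)).filter fun y =>
            #(univ.filter fun a => y a = true) = m - d ∧ Kf A ⊆ (univ.filter fun a => y a = true) ∧ f y = false) : ℝ) /
            (m.choose d : ℝ)) := sum_le_sum hA
      _ = _ := by
          rw [sum_add_distrib, sum_const, nsmul_eq_mul, hREJfib, mul_sum, sum_div]
          ring
  -- divide by the pair count
  rw [← sum_div, hpairs, div_le_iff₀ hpairs_pos]
  refine hnum.trans ?_
  -- compare the second term: `C(N-(m-d),d) · C(N-κ, m-d-κ) ≤ C(m,d) · C(N-κ, m-κ)`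
  have hREJ0 : 0 ≤ REJ := by rw [hREJ]; exact Nat.cast_nonneg _
  rcases lt_or_ge (m - d) κ with hlt | hge
  · -- below `κ` there are no pairs: `REJ = 0`
    have hREJz : REJ = 0 := by
      rw [hREJ, Nat.cast_eq_zero, card_eq_zero, filter_eq_empty_iff]
      rintro ⟨A, y⟩ hp ⟨hKy, hym, -⟩
      have := card_le_card hKy
      rw [hκ A (mem_product.1 hp).1] at this
      simp only at hym this
      omega
    rw [hREJz]
    simp only [mul_zero, zero_div, add_zero]
    nlinarith [hpairs_pos, hCmd]
  · have hchoose2_pos : (0 : ℝ) < ((N - κ).choose (m - d - κ) : ℝ) := by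
      exact_mod_cast Nat.choose_pos (by omega)
    -- the binomial identity `C(N-κ, m-κ) C(m-κ, d) = C(N-κ, m-d-κ) C(N-(m-d), d)`
    have hid : ((N - κ).choose (m - κ) : ℝ) * ((m - κ).choose d : ℝ) =
        ((N - κ).choose (m - d - κ) : ℝ) * ((N - (m - d)).choose d : ℝ) := by
      have h1 := Nat.choose_mul (n := N - κ) (k := m - κ) (s := m - κ - d) (Nat.sub_le _ _)
      rw [Nat.choose_symm (show d ≤ m - κ by omega), show m - κ - (m - κ - d) = d by omega,
        show N - κ - (m - κ - d) = N - (m - d) by omega, show m - κ - d = m - d - κ by omega] at h1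
      exact_mod_cast h1
    have hle : ((m - κ).choose d : ℝ) ≤ (m.choose d : ℝ) := by
      exact_mod_cast Nat.choose_le_choose d (Nat.sub_le m κ)
    have hkey : E * ((N - (m - d)).choose d : ℝ) * REJ / (m.choose d : ℝ) ≤
        E * (REJ / ((#𝒜 : ℝ) * ((N - κ).choose (m - d - κ) : ℝ))) * ((#𝒜 : ℝ) * ((N - κ).choose (m - κ) : ℝ)) := by
      rw [div_le_iff₀ hCmd]
      have hE0 : 0 ≤ E := Nat.cast_nonneg _
      calc E * ((N - (m - d)).choose d : ℝ) * REJ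
          = E * REJ * ((N - (m - d)).choose d : ℝ) := by ring
        _ ≤ E * REJ * (((N - κ).choose (m - κ) : ℝ) * (m.choose d : ℝ) / ((N - κ).choose (m - d - κ) : ℝ)) := by
            refine mul_le_mul_of_nonneg_left ?_ (mul_nonneg hE0 hREJ0)
            rw [le_div_iff₀ hchoose2_pos]
            calc ((N - (m - d)).choose d : ℝ) * ((N - κ).choose (m - d - κ) : ℝ)
                = ((N - κ).choose (m - κ) : ℝ) * ((m - κ).choose d : ℝ) := by rw [hid]; ring
              _ ≤ ((N - κ).choose (m - κ) : ℝ) * (m.choose d : ℝ) :=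
                  mul_le_mul_of_nonneg_left hle (Nat.cast_nonneg _)
        _ = E * (REJ / ((#𝒜 : ℝ) * ((N - κ).choose (m - d - κ) : ℝ))) *
              ((#𝒜 : ℝ) * ((N - κ).choose (m - κ) : ℝ)) * (m.choose d : ℝ) := by
            field_simp
    calc (#𝒜 : ℝ) * ((N - κ).choose (m - κ) : ℝ) * E * ((κ : ℝ) * d / m) +
          E * ((N - (m - d)).choose d : ℝ) * REJ / (m.choose d : ℝ)
        ≤ (#𝒜 : ℝ) * ((N - κ).choose (m - κ) : ℝ) * E * ((κ : ℝ) * d / m) +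
          E * (REJ / ((#𝒜 : ℝ) * ((N - κ).choose (m - d - κ) : ℝ))) * ((#𝒜 : ℝ) * ((N - κ).choose (m - κ) : ℝ)) :=
          add_le_add le_rfl hkey
      _ = _ := by ring

/-- **transport_average** (registered helper sub-goal of stmt-PneNP-18026 for `stub_transport`,
part 6): the null slice error of the transported test, averaged over all rankings, is the exact
acceptance fraction one `d` slices down (`sum_sliceErrI_del`). [folklore] -/
theorem transport_average :
    ∀ {α : Type*} [Fintype α] [DecidableEq α] (f : (α → Bool) → Bool) (m d : ℕ), d ≤ m → m ≤ Fintype.card α → ∑ σ : α ≃ Fin (Fintype.card α), (#((Finset.univ : Finset (α → Bool)).filter fun x => #(Finset.univ.filter fun a => x a = true) = m ∧ f (fun a => x a && decide (d ≤ #(Finset.univ.filter fun b => x b = true ∧ σ b < σ a))) = true) : ℝ) / #((Finset.univ : Finset (α → Bool)).filter fun x => #(Finset.univ.filter fun a => x a = true) = m) = (Fintype.card (α ≃ Fin (Fintype.card α)) : ℝ) * (#((Finset.univ : Finset (α → Bool)).filter fun y => #(Finset.univ.filter fun a => y a = true) = m - d ∧ f y = true) : ℝ) / ((Fintype.card α).choose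 (m - d) : ℝ) :=
  fun f _ _ hd hm => sum_sliceErrI_del f hd hm

end Summit.PneNP.PneNP.Theorems.MonotoneSuffices.SliceTransport
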